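import Summits.CriticalPhenomena.PercolationContinuityZ3.Theorems.FK.CylinderEdgeConditioning
import Summits.CriticalPhenomena.PercolationContinuityZ3.Theorems.FK.EdgeDensityDerivative
import Literature.Probability.LatticeModels.RandomClusterMonotonic
import Mathlib.Analysis.Calculus.Deriv.MeanValue
import HarnessLib

/-!
# Sprinkling for the random-cluster measure, 1/3: the one-edge step of Grimmett's sequential coupling
# (Grimmett 2006, proof of Thm. (3.45), (3.51)–(3.53)): given any cylinder condition, the conditional
# probability that an edge is open grows at rate `≥ 1/q` in `p`

Claimed R42 (8)(c) in the cell INBOX at 2026-08-27T11:05:32Z by fkp-10a gen 349 under provision (ι) (no coordinator fk-4 seated after g251 closed l.8021 2026-08-27T10:12Z; the lane lead absorbs the registry word; silence = consent; a seated coordinator’s word would govern); lineage row FO-10a-g349 (self-suggested), package g349-steepness, label ST-D.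
Support file of the `fk-continuity` cell (lineage fkp-10a, `--supports stmt-CriticalPhenomena-4575`); builds on
p205010 (kernel theorem, internal audit signed; external expert review pending).  No definitions, no named facts,
no sorries; standard axioms.  UNCONDITIONAL finite-graph random-cluster theory (`q ≥ 1`).

Grimmett 2006, proof of Theorem (3.45), pp. 54–55.  Notation as in `CylinderEdgeConditioning.lean`
(`C_T(π) = {ν | ν ∩ T = π}`, `J_e = {e open}`, `e ∈ E(G) ∖ T`, `π ⊆ T ⊆ E(G)`).
* **(3.52) given a cylinder**: `d/dp φ_p(J_e | C_T(π)) ≥ 1/q`, hence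
  `φ_s(J_e | C_T(π)) - φ_r(J_e | C_T(π)) ≥ (s-r)/q` for `r ≤ s` (`condProb_sub_condProb_ge`).  Grimmett obtains this
  from (3.52) on the graph with the examined edges contracted/deleted; here it is proved on `G` itself: by Russo's
  formula (Thm. (2.43), the tree's `hasDerivAt_rcMeasure_real`) the derivative of the quotient is
  `[Σ_f (φ(J_f ∩ J_e ∩ C) φ(C) - φ(J_e ∩ C) φ(J_f ∩ C))] / (p(1-p) φ(C)²)`, every `f ≠ e` term is `≥ 0` by FKG
  conditionally on the cylinder (Thm. (3.8)(b), `rcMeasure_real_fkg_cylinder`), and the `f = e` term gives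
  `g(1-g)/(p(1-p)) ≥ 1/q` for `g = φ_p(J_e | C) ∈ [p/(p+q(1-p)), p]` ((3.50));
* **(3.53), the step inequality of the coupling**: for `π ⊆ ω ⊆ T` and `r ≤ s`,
  `φ_s(J_e | C_T(ω)) - φ_r(J_e | C_T(π)) ≥ c · (1 - φ_r(J_e | C_T(π)))` with
  `c = ((s-r)/q) · (r+q(1-r))/(q(1-r))` (`condProb_sub_condProb_ge_mul_one_sub`), using the monotonicity of
  `φ_s(J_e | C_T(·))` in the prescription (Thm. (3.8)(b), `rcMeasure_real_cond_mono`).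

The coupling itself is `SprinklingCouplingFK.lean`; Theorem (3.45) is `SprinklingFK.lean`.

## Contents (namespace `Summit.CriticalPhenomena.PercolationContinuityZ3.Theorems.FK`)

* `mul_one_sub_le_mul_of_mem_Icc` (`p(1-p) ≤ q g(1-g)` on `[p/(p+q(1-p)), p]`);
* **`hasDerivAt_condProb_edgeOpen_cyl_ge`**, **`condProb_sub_condProb_ge`** ((3.52) given a cylinder);
* **`condProb_sub_condProb_ge_mul_one_sub`** ((3.53)).

## References

* G. Grimmett, *The Random-Cluster Model*, Springer 2006: §3.5 Thm. (3.45) and its proof, (3.50)–(3.53),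
  pp. 53–55; Thm. (2.43); Thm. (3.8)(b). [Grimmett2006]
* G. R. Grimmett, M. S. T. Piza, Comm. Math. Phys. 189 (1997) 465–480 (Grimmett's [163]). [GrimmettPiza1997]
-/

noncomputable section

open scoped Classical
open MeasureTheory Finset

namespace Summit.CriticalPhenomena.PercolationContinuityZ3.Theorems

namespace FK

open Literature.Probability.LatticeModels Literature.Probability.Percolation

section FiniteGraph

variable {V : Type*} [Fintype V] [DecidableEq V] (G : SimpleGraph V) [DecidableRel G.Adj]

/-! ### (3.52) given a cylinder: the conditional probability of `J_e` grows at rate `≥ 1/q` -/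

/-- Elementary: for `0 < p < 1`, `q ≥ 1` and `g ∈ [p/(p+q(1-p)), p]`: `p(1-p) ≤ q · g(1-g)` (the concave
function `g(1-g)` is bounded below by its values at the end points, both `≥ p(1-p)/q`).
[cite: Grimmett2006, proof of Thm. (3.45), display after (3.51)] -/
theorem mul_one_sub_le_mul_of_mem_Icc {p q g : ℝ} (hp : p ∈ Set.Ioo (0 : ℝ) 1) (hq : 1 ≤ q)
    (hg1 : p / (p + q * (1 - p)) ≤ g) (hg2 : g ≤ p) : p * (1 - p) ≤ q * (g * (1 - g)) := by
  have h1p : 0 < 1 - p := sub_pos.2 hp.2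
  have hd : 0 < p + q * (1 - p) := by nlinarith [hp.1]
  set π : ℝ := p / (p + q * (1 - p)) with hπ
  have hπd : π * (p + q * (1 - p)) = p := by rw [hπ]; field_simp
  have hπ0 : 0 < π := div_pos hp.1 hd
  have hprod : 0 ≤ (g - π) * (p - g) := mul_nonneg (sub_nonneg.2 hg1) (sub_nonneg.2 hg2)
  -- `g(1-g) ≥ g (1 - π - p) + π p`
  have hlin : g * (1 - π - p) + π * p ≤ g * (1 - g) := by nlinarith [hprod]
  -- the two end points: `q π(1-π) ≥ p(1-p)` and `q p(1-p) ≥ p(1-p)`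
  have hqd : p + q * (1 - p) ≤ q := by nlinarith [hp.1]
  have hend1 : p * (1 - p) ≤ q * (π * (1 - π)) := by
    -- `π(1-π) = p q (1-p) / d²` with `d = p + q(1-p) ≤ q`
    have h1 : π * (1 - π) * (p + q * (1 - p)) ^ 2 = p * (q * (1 - p)) := by
      have : (1 - π) * (p + q * (1 - p)) = q * (1 - p) := by nlinarith [hπd]
      calc π * (1 - π) * (p + q * (1 - p)) ^ 2
          = (π * (p + q * (1 - p))) * ((1 - π) * (p + q * (1 - p))) := by ring
        _ = p * (q * (1 - p)) := by rw [hπd, this]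
    have h2 : p * (1 - p) * (p + q * (1 - p)) ^ 2 ≤ q * (π * (1 - π)) * (p + q * (1 - p)) ^ 2 := by
      calc p * (1 - p) * (p + q * (1 - p)) ^ 2 ≤ p * (1 - p) * (q * q) := by
            refine mul_le_mul_of_nonneg_left ?_ (mul_nonneg hp.1.le h1p.le)
            nlinarith [hd]
        _ = q * (p * (q * (1 - p))) := by ring
        _ = q * (π * (1 - π)) * (p + q * (1 - p)) ^ 2 := by rw [← h1]; ring
    exact le_of_mul_le_mul_right h2 (pow_pos hd 2)
  have hend2 : p * (1 - p) ≤ q * (p * (1 - p)) := by nlinarith [mul_nonneg hp.1.le h1p.le]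
  by_cases hc : 0 ≤ 1 - π - p
  · -- use `g ≥ π`
    have : π * (1 - π) ≤ g * (1 - g) := by nlinarith [mul_le_mul_of_nonneg_right hg1 hc]
    nlinarith [this]
  · push Not at hc
    have : p * (1 - p) ≤ g * (1 - g) := by nlinarith [mul_le_mul_of_nonpos_right hg2 hc.le]
    nlinarith [this]

/-- **(3.52) for a conditional probability** (Grimmett 2006, proof of Thm. (3.45)): for `p ∈ (0,1)`, `q ≥ 1`, any
wired set `B`, `e ∈ E(G) ∖ T`, `π ⊆ T ⊆ E(G)`, the conditional probability `g(p) = φ^B_{G,p,q}(J_e | C_T(π))` is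
differentiable at `p` with derivative `≥ 1/q`: by Russo's formula the derivative is
`Σ_f [φ(J_f ∩ J_e ∩ C) φ(C) - φ(J_e ∩ C) φ(J_f ∩ C)] / (p(1-p) φ(C)²) ≥ g(1-g)/(p(1-p))` (FKG on the cylinder for
`f ≠ e`), and `g ∈ [p/(p+q(1-p)), p]` by (3.50). [cite: Grimmett2006, proof of Thm. (3.45), (3.50)–(3.52)] -/
theorem hasDerivAt_condProb_edgeOpen_cyl_ge {p q : ℝ} (hp : p ∈ Set.Ioo (0 : ℝ) 1) (hq : 1 ≤ q) (B : Set V)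
    {T π : Finset (Sym2 V)} {e : Sym2 V} (hT : T ⊆ G.edgeFinset) (hπ : π ⊆ T) (he : e ∈ G.edgeFinset)
    (heT : e ∉ T) :
    ∃ D : ℝ, HasDerivAt (fun r => (rcMeasure G r q B).real ({ν : BondConfig V | e ∈ ν} ∩ {ν | ν ∩ ↑T = ↑π}) /
        (rcMeasure G r q B).real {ν : BondConfig V | ν ∩ ↑T = ↑π}) D p ∧ 1 / q ≤ D := by
  have hq0 : 0 < q := one_pos.trans_le hq
  have hpI : p ∈ Set.Icc (0 : ℝ) 1 := ⟨hp.1.le, hp.2.le⟩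
  set C : Set (BondConfig V) := {ν : BondConfig V | ν ∩ ↑T = ↑π} with hC
  set J : Set (BondConfig V) := {ν : BondConfig V | e ∈ ν} with hJ
  have hv : 0 < (rcMeasure G p q B).real C := rcMeasure_real_cyl_pos G hp hq0 B hT hπ
  obtain hDu := hasDerivAt_rcMeasure_real G hq0 B (J ∩ C) hp
  obtain hDv := hasDerivAt_rcMeasure_real G hq0 B C hp
  refine ⟨_, hDu.div hDv hv.ne', ?_⟩
  rw [rcExpect_card_mul_ite_eq_sum G hpI hq0 B (J ∩ C), rcExpect_card_mul_ite_eq_sum G hpI hq0 B C]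
  -- abbreviations
  set u : ℝ := (rcMeasure G p q B).real (J ∩ C) with hu
  set v : ℝ := (rcMeasure G p q B).real C with hvdef
  set a : ℝ := ∑ f ∈ G.edgeFinset, (rcMeasure G p q B).real ({ν : BondConfig V | f ∈ ν} ∩ (J ∩ C)) with ha
  set b : ℝ := ∑ f ∈ G.edgeFinset, (rcMeasure G p q B).real ({ν : BondConfig V | f ∈ ν} ∩ C) with hb
  set m : ℝ := rcExpect G p q B (fun ω => (ω.card : ℝ)) with hm
  -- the key covariance inequality `a v - u b ≥ u (v - u)`
  have hK : u * (v - u) ≤ a * v - u * b := by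
    rw [ha, hb, Finset.sum_mul, Finset.mul_sum, ← Finset.sum_sub_distrib]
    rw [← Finset.add_sum_erase _ _ he]
    have hee : (rcMeasure G p q B).real ({ν : BondConfig V | e ∈ ν} ∩ (J ∩ C)) = u := by
      rw [hu, hJ, ← Set.inter_assoc, Set.inter_self]
    rw [hee]
    have hrest : 0 ≤ ∑ f ∈ G.edgeFinset.erase e,
        ((rcMeasure G p q B).real ({ν : BondConfig V | f ∈ ν} ∩ (J ∩ C)) * v -
          u * (rcMeasure G p q B).real ({ν : BondConfig V | f ∈ ν} ∩ C)) := by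
      refine Finset.sum_nonneg fun f _ => ?_
      have hfkg := rcMeasure_real_fkg_cylinder G hpI hq B (↑T : Set (Sym2 V)) (↑π : Set (Sym2 V))
        (A := {ν : BondConfig V | f ∈ ν}) (A' := J) (fun _ _ h hf => h hf) (fun _ _ h hf => h hf)
      have hset : {ν : BondConfig V | f ∈ ν} ∩ (J ∩ C) = {ν : BondConfig V | f ∈ ν} ∩ J ∩ C :=
        (Set.inter_assoc _ _ _).symm
      rw [hset]
      nlinarith [hfkg, mul_comm u ((rcMeasure G p q B).real ({ν : BondConfig V | f ∈ ν} ∩ C))]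
    nlinarith [hrest]
  -- bounds on `g = u / v`
  have hlo : p / (p + q * (1 - p)) * v ≤ u := div_mul_real_cyl_le_real_edgeOpen_inter_cyl G hpI hq B he heT
  have hhi : u ≤ p * v := real_edgeOpen_inter_cyl_le_mul_real_cyl G hpI hq B heT
  have hpp : 0 < p * (1 - p) := mul_pos hp.1 (sub_pos.2 hp.2)
  -- `p(1-p) v² ≤ q u (v - u)`
  have hkey : p * (1 - p) * v ^ 2 ≤ q * (u * (v - u)) := by
    have hg := mul_one_sub_le_mul_of_mem_Icc (g := u / v) hp hq
      (by rw [le_div_iff₀ hv]; exact hlo) (by rw [div_le_iff₀ hv]; exact hhi)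
    have : q * (u / v * (1 - u / v)) * v ^ 2 = q * (u * (v - u)) := by
      field_simp
    nlinarith [mul_le_mul_of_nonneg_right hg (sq_nonneg v), this]
  -- the derivative in closed form
  have hD : ((a - m * u) / (p * (1 - p)) * v - u * ((b - m * v) / (p * (1 - p)))) / v ^ 2 =
      (a * v - u * b) / (p * (1 - p) * v ^ 2) := by
    field_simp
    ring
  rw [hD, div_le_div_iff₀ hq0 (by positivity)]
  nlinarith [hK, hkey]

/-- **The increment form of (3.52)**: for `0 < r ≤ s < 1`, `q ≥ 1`, `e ∈ E(G) ∖ T`, `π ⊆ T ⊆ E(G)`: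
`φ_s(J_e | C_T(π)) - φ_r(J_e | C_T(π)) ≥ (s - r)/q`. [cite: Grimmett2006, proof of Thm. (3.45), eq. (3.52)] -/
theorem condProb_sub_condProb_ge {q : ℝ} (hq : 1 ≤ q) (B : Set V) {T π : Finset (Sym2 V)} {e : Sym2 V}
    (hT : T ⊆ G.edgeFinset) (hπ : π ⊆ T) (he : e ∈ G.edgeFinset) (heT : e ∉ T) {r s : ℝ} (hr : 0 < r)
    (hrs : r ≤ s) (hs : s < 1) :
    (s - r) / q ≤
      (rcMeasure G s q B).real ({ν : BondConfig V | e ∈ ν} ∩ {ν | ν ∩ ↑T = ↑π}) /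
          (rcMeasure G s q B).real {ν : BondConfig V | ν ∩ ↑T = ↑π} -
        (rcMeasure G r q B).real ({ν : BondConfig V | e ∈ ν} ∩ {ν | ν ∩ ↑T = ↑π}) /
          (rcMeasure G r q B).real {ν : BondConfig V | ν ∩ ↑T = ↑π} := by
  have hq0 : 0 < q := one_pos.trans_le hq
  set g : ℝ → ℝ := fun x => (rcMeasure G x q B).real ({ν : BondConfig V | e ∈ ν} ∩ {ν | ν ∩ ↑T = ↑π}) /
    (rcMeasure G x q B).real {ν : BondConfig V | ν ∩ ↑T = ↑π} with hg
  have hderiv : ∀ x ∈ Set.Icc r s, ∃ D, HasDerivAt g D x ∧ 1 / q ≤ D := fun x hx =>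
    hasDerivAt_condProb_edgeOpen_cyl_ge G ⟨hr.trans_le hx.1, lt_of_le_of_lt hx.2 hs⟩ hq B hT hπ he heT
  choose! D hD hDle using hderiv
  have hcont : ContinuousOn g (Set.Icc r s) := fun x hx => (hD x hx).continuousAt.continuousWithinAt
  have hdiff : DifferentiableOn ℝ g (interior (Set.Icc r s)) := by
    intro x hx
    rw [interior_Icc] at hx
    exact (hD x (Set.Ioo_subset_Icc_self hx)).differentiableAt.differentiableWithinAt
  have hge : ∀ x ∈ interior (Set.Icc r s), 1 / q ≤ deriv g x := by
    intro x hx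
    rw [interior_Icc] at hx
    rw [(hD x (Set.Ioo_subset_Icc_self hx)).deriv]
    exact hDle x (Set.Ioo_subset_Icc_self hx)
  have := Convex.mul_sub_le_image_sub_of_le_deriv (convex_Icc r s) hcont hdiff hge r
    (Set.left_mem_Icc.2 hrs) s (Set.right_mem_Icc.2 hrs) hrs
  rw [div_mul_eq_mul_div, one_mul] at this
  exact this

/-! ### (3.53): the step inequality of the sequential coupling -/

/-- **(3.53)** (Grimmett 2006, proof of Thm. (3.45)): for `0 < r ≤ s < 1`, `q ≥ 1`, `e ∈ E(G) ∖ T`,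
`π ⊆ ω ⊆ T ⊆ E(G)`:
`φ_s(J_e | C_T(ω)) - φ_r(J_e | C_T(π)) ≥ c · (1 - φ_r(J_e | C_T(π)))`, `c = ((s-r)/q)·(r+q(1-r))/(q(1-r))`
(monotonicity in the prescription, the increment `(s-r)/q` of (3.52), and `1 - φ_r(J_e | ·) ≤ q(1-r)/(r+q(1-r))`
by (3.50)). [cite: Grimmett2006, proof of Thm. (3.45), (3.51)–(3.53)] -/
theorem condProb_sub_condProb_ge_mul_one_sub {q : ℝ} (hq : 1 ≤ q) (B : Set V) {T π ω : Finset (Sym2 V)}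
    {e : Sym2 V} (hT : T ⊆ G.edgeFinset) (hπω : π ⊆ ω) (hω : ω ⊆ T) (he : e ∈ G.edgeFinset) (heT : e ∉ T)
    {r s : ℝ} (hr : 0 < r) (hrs : r ≤ s) (hs : s < 1) :
    (s - r) / q * ((r + q * (1 - r)) / (q * (1 - r))) *
        (1 - (rcMeasure G r q B).real ({ν : BondConfig V | e ∈ ν} ∩ {ν | ν ∩ ↑T = ↑π}) /
          (rcMeasure G r q B).real {ν : BondConfig V | ν ∩ ↑T = ↑π}) ≤
      (rcMeasure G s q B).real ({ν : BondConfig V | e ∈ ν} ∩ {ν | ν ∩ ↑T = ↑ω}) /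
          (rcMeasure G s q B).real {ν : BondConfig V | ν ∩ ↑T = ↑ω} -
        (rcMeasure G r q B).real ({ν : BondConfig V | e ∈ ν} ∩ {ν | ν ∩ ↑T = ↑π}) /
          (rcMeasure G r q B).real {ν : BondConfig V | ν ∩ ↑T = ↑π} := by
  have hq0 : 0 < q := one_pos.trans_le hq
  have hrI : r ∈ Set.Icc (0 : ℝ) 1 := ⟨hr.le, (hrs.trans hs.le)⟩
  have hsI : s ∈ Set.Icc (0 : ℝ) 1 := ⟨hr.le.trans hrs, hs.le⟩
  have hso : s ∈ Set.Ioo (0 : ℝ) 1 := ⟨hr.trans_le hrs, hs⟩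
  have hro : r ∈ Set.Ioo (0 : ℝ) 1 := ⟨hr, lt_of_le_of_lt hrs hs⟩
  have hπ : π ⊆ T := hπω.trans hω
  set vr := (rcMeasure G r q B).real {ν : BondConfig V | ν ∩ ↑T = ↑π} with hvr
  set ur := (rcMeasure G r q B).real ({ν : BondConfig V | e ∈ ν} ∩ {ν | ν ∩ ↑T = ↑π}) with hur
  set vs := (rcMeasure G s q B).real {ν : BondConfig V | ν ∩ ↑T = ↑ω} with hvs
  set us := (rcMeasure G s q B).real ({ν : BondConfig V | e ∈ ν} ∩ {ν | ν ∩ ↑T = ↑ω}) with hus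
  set vs' := (rcMeasure G s q B).real {ν : BondConfig V | ν ∩ ↑T = ↑π} with hvs'
  set us' := (rcMeasure G s q B).real ({ν : BondConfig V | e ∈ ν} ∩ {ν | ν ∩ ↑T = ↑π}) with hus'
  have hvr0 : 0 < vr := rcMeasure_real_cyl_pos G hro hq0 B hT hπ
  have hvs0 : 0 < vs := rcMeasure_real_cyl_pos G hso hq0 B hT hω
  have hvs'0 : 0 < vs' := rcMeasure_real_cyl_pos G hso hq0 B hT hπ
  -- monotonicity in the prescription: `us'/vs' ≤ us/vs`
  have hmono : us' / vs' ≤ us / vs := by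
    rw [div_le_div_iff₀ hvs'0 hvs0]
    have h := rcMeasure_real_cond_mono G hsI hq B (↑T : Set (Sym2 V)) (ξ := (↑π : Set (Sym2 V)))
      (ζ := (↑ω : Set (Sym2 V))) (Finset.coe_subset.2 hπω) (A := {ν : BondConfig V | e ∈ ν})
      (fun _ _ h hf => h hf)
    linarith [h]
  -- the increment `(s-r)/q ≤ us'/vs' - ur/vr`
  have hinc := condProb_sub_condProb_ge G hq B hT hπ he heT hr hrs hs
  -- finite energy: `1 - ur/vr ≤ q(1-r)/(r+q(1-r))`
  have hlo : r / (r + q * (1 - r)) * vr ≤ ur := div_mul_real_cyl_le_real_edgeOpen_inter_cyl G hrI hq B he heT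
  have h1r : 0 < 1 - r := by linarith
  have hd : 0 < r + q * (1 - r) := add_pos_of_pos_of_nonneg hr (mul_nonneg hq0.le h1r.le)
  have hfe : 1 - ur / vr ≤ q * (1 - r) / (r + q * (1 - r)) := by
    have : r / (r + q * (1 - r)) ≤ ur / vr := by rw [le_div_iff₀ hvr0]; exact hlo
    have heq : q * (1 - r) / (r + q * (1 - r)) = 1 - r / (r + q * (1 - r)) := by
      field_simp
      ring
    rw [heq]
    linarith
  have hc0 : 0 ≤ (s - r) / q := div_nonneg (sub_nonneg.2 hrs) hq0.le
  calc (s - r) / q * ((r + q * (1 - r)) / (q * (1 - r))) * (1 - ur / vr)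
      ≤ (s - r) / q * ((r + q * (1 - r)) / (q * (1 - r))) * (q * (1 - r) / (r + q * (1 - r))) :=
        mul_le_mul_of_nonneg_left hfe (mul_nonneg hc0 (by positivity))
    _ = (s - r) / q := by field_simp
    _ ≤ us' / vs' - ur / vr := hinc
    _ ≤ us / vs - ur / vr := by linarith

end FiniteGraph

end FK

end Summit.CriticalPhenomena.PercolationContinuityZ3.Theorems

end
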